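import Summits.BirchSwinnertonDyer.BirchSwinnertonDyer.Theses.TameQuarticManinParity
import Summits.BirchSwinnertonDyer.BirchSwinnertonDyer.Theorems.TameQuarticManinParityTwistPairAtThree
import Summits.BirchSwinnertonDyer.Rank1Residual.X11b.TwistTransportIrr
import Summits.BirchSwinnertonDyer.Rank1Residual.X12.CMIsogenyInvariance
import Summits.BirchSwinnertonDyer.Rank1Residual.O6.X3WildOfKMCTorsionFreeMember
import Literature.NumberTheory.Automorphic.ShimuraCurveRibetTakahashiOptimalModularityProofs
import Literature.NumberTheory.EllipticCurves.ModularCurveManinSemistableBridgeProofs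
import Literature.NumberTheory.EllipticCurves.IsogenyPotentiallyGoodMinimalDiscriminant
import Literature.NumberTheory.EllipticCurves.SkinnerUrban2014.PAdicUnitPeriodRatioProofs
import Literature.NumberTheory.EllipticCurves.Rank1Residual.GVParityTwistTransportProofs
import Literature.NumberTheory.EllipticCurves.ComplexMultiplicationHasCMProofs
import Literature.NumberTheory.EllipticCurves.CuspFormLFunctionLevelConductorProofs
import Literature.NumberTheory.EllipticCurves.IsogenyQuadraticTwistProofs
import Literature.NumberTheory.EllipticCurves.QuadraticTwistLocalPolynomialTwoProofs
import Literature.NumberTheory.EllipticCurves.IsogenyDualProofs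
import Literature.NumberTheory.EllipticCurves.IsogenyCompProofs
import Literature.NumberTheory.Automorphic.BCDTTheoremB
import HarnessLib

/-!
# Route `TameQuarticManinParity`, LINE 22 (bsd-idea-3 g8), support X22 `TprimeIrrTwistPartnerOptimalDatum`
# (stmt-BirchSwinnertonDyer-28190) — GRANTED modularity and Dokchitser–Dokchitser 2015 Thm. 5.1 (1)

Cell `pub/bsd-wall`, D-0145 line `route-BirchSwinnertonDyer-TeichmullerTwistDescent`, seat `bsd-line-ttd-p1` g10,
working the planner-of-record's TQMP LINE 22. BSD is NOT proved by this; Manin's conjecture is not proved by this;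
X22 itself stays OPEN: this file proves it from the two PUBLISHED, cite-only named facts of the route's cone

* `exists_isNewformOf` (modularity, BCDT 2001 Thm. A — used twice: to give the `−3`-twisted curve a newform AT ITS
  CONDUCTOR, and to identify the level of the optimal datum with the conductor of the optimal curve, Carayol), and
* `dokchitser_padicValInt_minimalDiscriminantInt_eq_of_isogeny_of_not_dvd_degree` (Dokchitser–Dokchitser 2015,
  Thm. 5.1 (1), clause `l ≠ p`: an isogeny of degree prime to `3` preserves `ord₃ Δ_min` at a potentially good `3`).

## Statement

`exists_isNewformOf → dokchitser_… → TprimeIrrTwistPartnerOptimalDatum`: for `W/ℚ` globally minimal, non-CM, in the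
tame quartic cell (t′) at `3` with `E[3]` irreducible, there is a globally minimal `A` with `A ⊗ χ₋₃ ∼ W`, of the
OPPOSITE Kodaira type at `3` (`ord₃ Δ_min(A) + ord₃ Δ_min(W) = 12`), non-CM, (t′), `E[3]`-irreducible, `N(A) = N(W)`,
carrying a conductor-level datum that is LATTICE-OPTIMAL (`Λ_A = c·Λ_f`) and DEGREE-MINIMAL — the `X₀(N)`-optimal
curve of the twisted class.

## Proof

`V := C • (W ⊗ χ₋₃)` globally minimal is again (t′) with the Kodaira symbol flipped and `N(V) = N(W)`
(`TwistPairAtThree.addv_and_subTprime_of_twist_negThree`, `padicValRat_u_eq_zero_of_III` / `_one_of_IIIstar`,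
`conductorNorm_eq_of_twist_negThree`). Modularity gives the newform `f_V` of `V` at level `N(V)`; the tree's
UNCONDITIONAL optimal-quotient theorem `exists_optimal_modularParametrizationData_of_isNewformOf'` (Eichler–Shimura
with its lattice + Edixhoven 1991 Prop. 2, a theorem of the tree) gives a globally minimal `A ∼ V` with a
degree-minimal datum `D₀` of newform `f_V`, which is lattice-optimal by `exists_optimalDatum'` +
`latticeEq_of_modularDegree_le` (Knapp Prop. 12.9). `N(A) = N(V)` by Carayol through modularity
(`IsNewformOf.level_eq_conductorNorm_of_exists_isNewformOf`). Transfers along `A ∼ V ≅ W ⊗ χ₋₃`: CM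
(`X12.hasCM_iff_of_isIsogenous`, `hasCM_iff_of_j_eq`), irreducibility of `E[3]` (`hasIrreducibleModPGaloisRep_quadraticTwist`,
`not_hasIrreducibleModPGaloisRep_of_isIsogenous`), additivity with integral `j` (`Addv.of_isIsogenous_of_padicValRat_j_nonneg`),
`f₃ = 2` (conductor equality), and `ord₃ Δ_min(A) = ord₃ Δ_min(V)` by Dokchitser–Dokchitser along an isogeny
`V → A` of degree prime to `3` (`SkinnerUrban2014.exists_isogeny_not_dvd_degree_of_irreducible`, from `E[3]`
irreducible) — which also transports the semistability index `e = 4`, hence (t′). Design: theorems only; no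
definition, no new named fact, no `sorry`; axioms `propext`, `Classical.choice`, `Quot.sound`.
-/

set_option autoImplicit false
-- D-0017: single-problem summit, so `Summit.BirchSwinnertonDyer.BirchSwinnertonDyer.…` repeats a namespace BY DESIGN.
set_option linter.dupNamespace false

noncomputable section

open scoped Classical

namespace Summit.BirchSwinnertonDyer.BirchSwinnertonDyer.Theorems.TameQuarticManinParity

open WeierstrassCurve IsDedekindDomain Rat.HeightOneSpectrum
  Literature.NumberTheory.EllipticCurves Literature.NumberTheory.EllipticCurves.ModularForms
  Literature.NumberTheory.EllipticCurves.Rank1Residual Literature.NumberTheory.Automorphic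
  Summit.BirchSwinnertonDyer.Rank1Residual Summit.BirchSwinnertonDyer.Rank1Residual.Additive
  Summit.BirchSwinnertonDyer.BirchSwinnertonDyer.Theses.TameQuarticManinParity

/-! ## §1 Bookkeeping -/

/-- **Re-levelling a datum**: a datum of `A` at a level `N` propositionally equal to `N(A)`, lattice-optimal and
degree-minimal at level `N`, is such a datum at level `N(A)` (transport along `N(A) = N`). [folklore] -/
theorem exists_datum_conductorLevel_of_eq (A : WeierstrassCurve ℚ) [A.IsElliptic] [NeZero (A.conductorNorm ℤ)]
    {N : ℕ} [NeZero N] (hN : A.conductorNorm ℤ = N) (D₀ : ModularParametrizationData A N)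
    (hopt : ∀ z ∈ D₀.L.lattice, ∃ w ∈ periodLattice D₀.f, z = D₀.c * w)
    (hmin : ∀ (W₂ : WeierstrassCurve ℚ) [W₂.IsElliptic] (D₂ : ModularParametrizationData W₂ N),
      D₂.f = D₀.f → D₀.modularDegree ≤ D₂.modularDegree) :
    ∃ D' : ModularParametrizationData A (A.conductorNorm ℤ),
      (∀ z ∈ D'.L.lattice, ∃ w ∈ periodLattice D'.f, z = D'.c * w) ∧
      (∀ (W'' : WeierstrassCurve ℚ) [W''.IsElliptic]
        (D₁ : ModularParametrizationData W'' (A.conductorNorm ℤ)), D₁.f = D'.f →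
          D'.modularDegree ≤ D₁.modularDegree) := by
  subst hN
  exact ⟨D₀, hopt, fun W'' _ D₁ h ↦ hmin W'' D₁ h⟩

/-- **`f₃ = 2` transfers along an equality of conductors.** [folklore] -/
theorem condExpTwo_of_conductorNorm_eq {A V : WeierstrassCurve ℚ} [A.IsElliptic] [V.IsElliptic]
    (hN : A.conductorNorm ℤ = V.conductorNorm ℤ) (hV : CondExpTwo V 3) : CondExpTwo A 3 := by
  have hgen : natGenerator (placeOf 3) = 3 :=
    Literature.NumberTheory.EllipticCurves.Rat.natGenerator_primesEquiv_symm ⟨3, Nat.prime_three⟩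
  have hA' := A.factorization_conductorNorm_holds (placeOf 3)
  have hV' := V.factorization_conductorNorm_holds (placeOf 3)
  rw [hgen] at hA' hV'
  unfold CondExpTwo condExp at hV ⊢
  rw [← hA', hN, hV']
  exact hV

/-! ## §2 X22 granted modularity and Dokchitser–Dokchitser -/

/-- **X22 `TprimeIrrTwistPartnerOptimalDatum` (stmt-BirchSwinnertonDyer-28190) GRANTED the two published named facts
`exists_isNewformOf` (modularity) and `dokchitser_padicValInt_minimalDiscriminantInt_eq_of_isogeny_of_not_dvd_degree`
(Dokchitser–Dokchitser 2015 Thm. 5.1 (1)).** See the module docstring for the chain.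
[cite: BCDTJAMS2001, Thm. A] [cite: DokchitserDokchitser2015LocalInvariants, Thm. 5.1 (1)]
[cite: Knapp1993, Thm. 11.74 and Prop. 12.9] [cite: EdixhovenManin1991, Prop. 2] -/
theorem tprimeIrrTwistPartnerOptimalDatum_of_modularity_of_dokchitser (hnf : exists_isNewformOf)
    (hDD : dokchitser_padicValInt_minimalDiscriminantInt_eq_of_isogeny_of_not_dvd_degree) :
    TprimeIrrTwistPartnerOptimalDatum := by
  intro W _ _ _ hcm hadd ht hirr _D
  -- §a the twisted curve `V = C • (W ⊗ χ₋₃)`, globally minimal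
  have e : ((-1 : ℚ) ^ (3 / 2) * 3) = -3 := by norm_num
  have hd0 : (-3 : ℚ) ≠ 0 := by norm_num
  haveI hXt : (W.quadraticTwist (-3 : ℚ)).IsElliptic := W.isElliptic_quadraticTwist hd0
  obtain ⟨C, hVmin⟩ := hasGlobalMinimalModel_rat_holds (W.quadraticTwist (-3 : ℚ))
  set V := C • W.quadraticTwist (-3 : ℚ) with hV
  have hC : C • W.quadraticTwist ((-1 : ℚ) ^ (3 / 2) * 3) = V := by rw [e]
  obtain ⟨haddV, htV⟩ := TwistPairAtThree.addv_and_subTprime_of_twist_negThree W V C hadd ht hC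
  have hjV : 0 ≤ padicValRat 3 V.j := not_lt.mp htV.1
  -- the Kodaira symbol flips: `ord₃ Δ_min(V) + ord₃ Δ_min(W) = 12`
  have hsumV : padicValInt 3 V.minimalDiscriminantInt + padicValInt 3 W.minimalDiscriminantInt = 12 := by
    rcases TwistPairAtThree.padicValInt_eq_three_or_nine_of_subTprime W hadd ht with h3 | h9
    · have := (TwistPairAtThree.padicValRat_u_eq_zero_of_III W V C h3 hC).2; omega
    · have := (TwistPairAtThree.padicValRat_u_eq_one_of_IIIstar W V C hadd ht h9 hC).2; omega
  have hNV : V.conductorNorm ℤ = W.conductorNorm ℤ :=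
    TwistPairAtThree.conductorNorm_eq_of_twist_negThree W V C hadd ht hC
  haveI : NeZero (V.conductorNorm ℤ) := ⟨(V.conductorNorm_pos_holds).ne'⟩
  -- §b modularity of `V` and the optimal curve `A` of its class
  obtain ⟨fV, hfV⟩ := hnf V
  obtain ⟨A, hAell, hAmin, D₀, hD₀f, hVA, hmin⟩ :=
    exists_optimal_modularParametrizationData_of_isNewformOf' (V.conductorNorm ℤ) V rfl hfV
  haveI := hAell
  haveI := hAmin
  -- lattice-optimality of the degree-minimal datum
  obtain ⟨W₁, hW₁, D₁, hD₁f, hD₁opt⟩ := D₀.exists_optimalDatum'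
  haveI := hW₁
  have hle : D₀.modularDegree ≤ D₁.modularDegree := hmin W₁ D₁ (hD₁f.trans hD₀f)
  have hD₀opt : ∀ z ∈ D₀.L.lattice, ∃ w ∈ periodLattice D₀.f, z = D₀.c * w :=
    D₀.latticeEq_of_modularDegree_le D₁ hD₁f hD₁opt hle
  -- conductor of `A` (Carayol through modularity)
  have hNA : A.conductorNorm ℤ = V.conductorNorm ℤ :=
    (IsNewformOf.level_eq_conductorNorm_of_exists_isNewformOf hnf D₀.isNewformOf).symm
  haveI : NeZero (A.conductorNorm ℤ) := ⟨(A.conductorNorm_pos_holds).ne'⟩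
  -- §c transfers along `A ∼ V ≅ W ⊗ χ₋₃`
  have hAV : IsIsogenous A V := hVA.symm_of_charZero
  have hirrX : (W.quadraticTwist (-3 : ℚ)).HasIrreducibleModPGaloisRep 3 :=
    X11b.hasIrreducibleModPGaloisRep_quadraticTwist W BCDT.not_isSquare_neg_three 3 hirr
  have hirrV : V.HasIrreducibleModPGaloisRep 3 := by
    rw [hV, Mazur1978.hasIrreducibleModPGaloisRep_smul_iff]; exact hirrX
  have hirrA : A.HasIrreducibleModPGaloisRep 3 := by
    by_contra hA
    exact not_hasIrreducibleModPGaloisRep_of_isIsogenous hAV hA hirrV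
  -- an isogeny of degree prime to `3` and Dokchitser–Dokchitser
  obtain ⟨ψ, hψ⟩ := SkinnerUrban2014.exists_isogeny_not_dvd_degree_of_irreducible (p := 3)
    (by norm_num : ((3 : ℕ) : ℚ) ≠ 0) hirrV hVA
  have hΔ : padicValInt 3 V.minimalDiscriminantInt = padicValInt 3 A.minimalDiscriminantInt :=
    hDD V A ψ 3 Nat.prime_three hψ hjV
  have hsumA : padicValInt 3 A.minimalDiscriminantInt + padicValInt 3 W.minimalDiscriminantInt = 12 := by
    rw [← hΔ]; exact hsumV
  -- (t′) for `A`
  obtain ⟨haddA, hjA⟩ :=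
    Summit.BirchSwinnertonDyer.Rank1Residual.Additive.Addv.of_isIsogenous_of_padicValRat_j_nonneg (p := 3)
      haddV hjV hVA
  have htA : SubTprime A 3 := by
    refine ⟨not_lt.mpr hjA, condExpTwo_of_conductorNorm_eq hNA htV.2.1, ?_⟩
    unfold semistabilityIndex
    rw [← hΔ]
    exact htV.2.2
  -- CM
  have hjVW : V.j = W.j := by
    show (C • W.quadraticTwist (-3 : ℚ)).j = W.j
    rw [variableChange_j, W.j_quadraticTwist hd0]
  have hcmA : ¬ A.HasCM := fun h ↦
    hcm ((hasCM_iff_of_j_eq hjVW).mp ((X12.hasCM_iff_of_isIsogenous hVA).mpr h))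
  -- `A ⊗ χ₋₃ ∼ W`
  have hAX : IsIsogenous A (W.quadraticTwist (-3 : ℚ)) :=
    hAV.trans' (isIsogenous_of_smul (W.quadraticTwist (-3 : ℚ)) C)
  obtain ⟨D, hDW⟩ := exists_quadraticTwist_quadraticTwist_eq_smul W hd0
  have hAW : IsIsogenous (A.quadraticTwist (-3 : ℚ)) W := by
    have h1 : IsIsogenous (A.quadraticTwist (-3 : ℚ)) ((W.quadraticTwist (-3 : ℚ)).quadraticTwist (-3 : ℚ)) :=
      hAX.quadraticTwist hd0
    rw [hDW] at h1
    exact h1.trans' (isIsogenous_of_smul W D)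
  -- §d assemble
  obtain ⟨D', hD'opt, hD'min⟩ := exists_datum_conductorLevel_of_eq A hNA D₀ hD₀opt
    fun W₂ _ D₂ h ↦ hmin W₂ D₂ (h.trans hD₀f)
  exact ⟨A, hAell, hAmin, inferInstance, hsumA, hAW, hcmA, haddA, htA, hirrA, hNA.trans hNV, D', hD'opt, hD'min⟩

end Summit.BirchSwinnertonDyer.BirchSwinnertonDyer.Theorems.TameQuarticManinParity

end
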